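import Summits.QuantumFields.YangMills.Theorems.IR.PurityChannelAnchorRooting
import Literature.MathematicalPhysics.QuantumFieldTheory.PeriodicBoxFreeEnergy
import HarnessLib

/-!
# Crux `IR` (stmt-QuantumFields-19354) — purity-channel family: towards the located supplier `ComplexAnchor`
# Part 3: tubes `a³ × t` with general covariant factors — `log Z(a³×t) = t·E_m + O(a³ t e^{−m})`, two tubes, zero-freeness

Helper module for item `stmt-QuantumFields-19354` (`--supports … --as helper`; closes nothing, asserts nothing new).
Sequel of `PurityChannelAnchorTransport` / `PurityChannelAnchorRooting`: the tube step of the strong-coupling expansion of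
the free energy (Seiler LNP 159 Ch. 3; the tree's `PeriodicBoxFreeEnergy.norm_pertLogZ_tube_sub_mul_le` for the Wilson
weight) for a GENERAL size-indexed family of cell factors `f n p : ZdGaugeConfig 4 G → ℂ` on the labels of the
four-dimensional periodic boxes, subject to: measurability, dependence on the bonds of the label only, the uniform bound
`‖f n p U‖ ≤ ε` with the two-weight smallness `e² ε (16·4²+1)² ≤ 1/2`, covariance under the translations of the time
coordinate `3`, and compatibility with the inclusions `castLE` of boxes on non-wrapping labels.

* `sum_small_eq_size_mul_sum_of_iff_of_covariant` — one rooting step, robust to decidability instances;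
* `norm_pertLogZ_tube_sub_mul_le_of_covariant` — `‖log Z(a³×t) − t·E_m‖ ≤ 6a³t e^{−m}` for `2m ≤ t`, `m+1 ≤ t`, with the
  rooted small-cluster sum `E_m` of the reference tube `a³×(m+1)` (independent of `t`);
* `norm_pertLogZ_two_tubes_le_of_covariant` — `‖log Z(a³×2t) − 2 log Z(a³×t)‖ ≤ 24 a³ t e^{−⌊t/2⌋}` (`t ≥ 1`): the bulk
  `t·E_m` CANCELS in the purity combination, only the tails survive;
* `pertZ_ne_zero_of_factors`, `exp_pertLogZ_of_factors` — zero-freeness and `exp (log Z) = Z` for general factors on any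
  box (Dobrushin smallness).

Everything is proved; no definitions; no named facts.

HONEST FRAMING: strong-coupling bookkeeping, group-blind; width 0 toward `IR` (19354); nothing here bears on confinement, a
lattice gap or the Yang–Mills mass gap (Clay), which are NOT proved; `R4` closes only `BalabanLadder.UV`.
-/

set_option autoImplicit false

noncomputable section

open MeasureTheory ProbabilityTheory Finset Filter
open Literature.Probability.LatticeModels
open Literature.MathematicalPhysics.QuantumFieldTheory

namespace Summit.QuantumFields.YangMills.Cruxes.IR.PurityChannelFamily

variable {G : Type*} [Group G] [TopologicalSpace G] [IsTopologicalGroup G] [CompactSpace G]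
  [MeasurableSpace G] [BorelSpace G] {N : ℕ} {ρ : G →* Matrix (Fin N) (Fin N) ℂ}

/-! ## §1 Zero-freeness and `exp (log Z) = Z` for general factors on one box -/

section OneBox

variable {d : ℕ} {n : Fin d → ℕ} {f : BoxLabel n → ZdGaugeConfig d G → ℂ} {ε : ℝ}

/-- **Zero-freeness** of the perturbed partition function of general factors on a periodic box: if the factors are
measurable, depend only on the bonds of their labels and are bounded by `ε` with `e ε (16d²+1)² ≤ 1/2`, then
`Z(W) = ∫ ∏_{p∈W} (1 + f p) dν ≠ 0` for every label set `W` (the tree's `pertZ_ne_zero`).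
[Friedli–Velenik 2017 Thm. 5.4; Dobrushin 1996] -/
theorem pertZ_ne_zero_of_factors (hε : 0 ≤ ε) (hmeas : ∀ p, Measurable (f p))
    (hdep : ∀ p : BoxLabel n, DependsOn (f p) ((p.bonds : Finset (ZdEdge d)) : Set (ZdEdge d)))
    (hnorm : ∀ p U, ‖f p U‖ ≤ ε) (hε1 : Real.exp 1 * ε * ((boxDeg d : ℝ) + 1) ^ 2 ≤ 1 / 2)
    (W : Finset (BoxLabel n)) : pertZ (zdHaar d G) f W ≠ 0 := by
  classical
  -- the adjacency of the box system does not depend on the representation: use the trivial one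
  set ρ₁ : G →* Matrix (Fin 1) (Fin 1) ℂ := 1 with hρ₁
  have hLP := isLocalPerturbation_of_factors (S := boxSystem (G := G) ρ₁ n) hε hmeas hdep hnorm
  exact pertZ_ne_zero (R := (boxSystem (G := G) ρ₁ n).Adj) (symm_of_inst (R := (boxSystem (G := G) ρ₁ n).Adj))
    (card_near_boxSystem_le (ρ := ρ₁)) (fun x y h => (boxSystem (G := G) ρ₁ n).mem_near x y h) hLP hε1 W

/-- **`exp (log Z(W)) = Z(W)`** for general factors on a periodic box under `e ε (16d²+1)² ≤ 1/2`: the Kotecký–Preiss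
logarithm `pertLogZ` of the polymer gas is a logarithm of the perturbed partition function (the tree's `exp_pertLogZ`).
[Kotecký–Preiss 1986, §2 and Theorem p. 492] -/
theorem exp_pertLogZ_of_factors (hε : 0 ≤ ε) (hmeas : ∀ p, Measurable (f p))
    (hdep : ∀ p : BoxLabel n, DependsOn (f p) ((p.bonds : Finset (ZdEdge d)) : Set (ZdEdge d)))
    (hnorm : ∀ p U, ‖f p U‖ ≤ ε) (hε1 : Real.exp 1 * ε * ((boxDeg d : ℝ) + 1) ^ 2 ≤ 1 / 2)
    (W : Finset (BoxLabel n)) :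
    Complex.exp (pertLogZ (zdHaar d G) f (boxSystem (G := G) ρ n).Adj W) = pertZ (zdHaar d G) f W := by
  classical
  have hLP := isLocalPerturbation_of_factors (S := boxSystem (G := G) ρ n) hε hmeas hdep hnorm
  exact exp_pertLogZ (R := (boxSystem (G := G) ρ n).Adj)
    (card_near_boxSystem_le (ρ := ρ)) (fun x y h => (boxSystem (G := G) ρ n).mem_near x y h) hLP hε1 W

end OneBox

/-! ## §2 Tubes `a³ × t`: the truncated expansion `log Z = t·E_m + O(a³ t e^{−m})` and two tubes -/

section Tube

variable {f : (n : Fin 4 → ℕ) → BoxLabel n → ZdGaugeConfig 4 G → ℂ} {ε : ℝ}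

/-- One rooting step on a four-dimensional box of sizes `n` for general rotation-covariant factors, in a form robust to
the spelling of the predicates and to the decidability instances: for `Q` translation invariant in the direction `i` and
`Q' ↔ Q ∧ rooted in i`, `Σ_{small, Q} Φ^T = nᵢ · Σ_{small, Q'} Φ^T` (general-factor form of the tree's
`sum_small_eq_size_mul_sum_of_iff`). [Seiler LNP 159 Ch. 2] -/
theorem sum_small_eq_size_mul_sum_of_iff_of_covariant {n : Fin 4 → ℕ} (hε : 0 ≤ ε)
    (hmeas : ∀ p : BoxLabel n, Measurable (f n p))
    (hdep : ∀ p : BoxLabel n, DependsOn (f n p) ((p.bonds : Finset (ZdEdge 4)) : Set (ZdEdge 4)))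
    (hnorm : ∀ (p : BoxLabel n) (U : ZdGaugeConfig 4 G), ‖f n p U‖ ≤ ε)
    (hε1 : Real.exp 1 * ε * ((boxDeg 4 : ℝ) + 1) ^ 2 ≤ 1 / 2) (i : Fin 4)
    (hrot : ∀ (s : ℕ) (p : BoxLabel n) (U : ZdGaugeConfig 4 G),
      f n (BoxLabel.rot i s p) U = f n p (U ∘ boxEdgeRot n i s))
    {m : ℕ} (hm : 2 * m ≤ n i) (Q Q' : Finset (Finset (BoxLabel n)) → Prop)
    [DecidablePred Q] [DecidablePred Q']
    (hQ : ∀ (s : ℕ) (𝒞 : Finset (Finset (BoxLabel n))), Q (𝒞.image (Finset.image (BoxLabel.rot i s))) ↔ Q 𝒞)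
    (hQ' : ∀ 𝒞, Q' 𝒞 ↔ Q 𝒞 ∧ BoxRooted i m 𝒞) :
    ∑ 𝒞 ∈ ((rconnSubsets (boxSystem (G := G) ρ n).Adj Finset.univ).powerset.filter
        fun 𝒞 => ∑ Y ∈ 𝒞, (Y.card : ℝ) < m) with Q 𝒞,
        truncatedWeight (GeomInc (boxSystem (G := G) ρ n).Adj)
          (connActivity (boxSystem (G := G) ρ n).Adj (zdHaar 4 G) (f n)) 𝒞 =
      (n i : ℂ) * ∑ 𝒞 ∈ ((rconnSubsets (boxSystem (G := G) ρ n).Adj Finset.univ).powerset.filter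
        fun 𝒞 => ∑ Y ∈ 𝒞, (Y.card : ℝ) < m) with Q' 𝒞,
        truncatedWeight (GeomInc (boxSystem (G := G) ρ n).Adj)
          (connActivity (boxSystem (G := G) ρ n).Adj (zdHaar 4 G) (f n)) 𝒞 := by
  classical
  have hLP := isLocalPerturbation_of_factors (S := boxSystem (G := G) ρ n) hε hmeas hdep hnorm
  have h1 := sum_small_eq_size_mul_sum_boxRooted_of_covariant (d := 4) (G := G) (ρ := ρ) hLP hε1 hmeas hdep i
    hrot hm Q hQ
  refine (sum_filter_congr_prop (fun _ _ => Iff.rfl) _).trans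
    (h1.trans (congrArg (fun x => ((n i : ℕ) : ℂ) * x) ?_))
  exact sum_filter_congr_prop (fun 𝒞 _ => (hQ' 𝒞).symm) _

open scoped Classical in
/-- **Tubes: `log Z(a³ × t) = t · E_m + O(a³ t e^{−m})` for general covariant factors.**  For a size-indexed family of
factors on the four-dimensional periodic boxes — measurable, depending only on the bonds of the label, bounded by `ε` with
`e² ε (16·4²+1)² ≤ 1/2`, covariant under the translations of the time coordinate `3`, compatible with the inclusions of boxes
on non-wrapping labels — and for `2m ≤ t`, `m + 1 ≤ t`, the Kotecký–Preiss logarithm of the perturbed partition function of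
the tube `a³ × t` differs from `t` times the rooted small-cluster sum `E_m` of the reference tube `a³ × (m+1)` by at most
`6a³t · e^{−m}` (tail of the cluster expansion; translation invariance in the time direction; independence of the rooted
small clusters of the length).  General-factor form of the tree's `norm_pertLogZ_tube_sub_mul_le`. [Seiler LNP 159 Ch. 3] -/
theorem norm_pertLogZ_tube_sub_mul_le_of_covariant (hε : 0 ≤ ε)
    (hmeas : ∀ (n : Fin 4 → ℕ) (p : BoxLabel n), Measurable (f n p))
    (hdep : ∀ (n : Fin 4 → ℕ) (p : BoxLabel n), DependsOn (f n p) ((p.bonds : Finset (ZdEdge 4)) : Set (ZdEdge 4)))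
    (hnorm : ∀ (n : Fin 4 → ℕ) (p : BoxLabel n) (U : ZdGaugeConfig 4 G), ‖f n p U‖ ≤ ε)
    (hε2 : Real.exp 2 * ε * ((boxDeg 4 : ℝ) + 1) ^ 2 ≤ 1 / 2)
    (hrot : ∀ (n : Fin 4 → ℕ) (s : ℕ) (p : BoxLabel n) (U : ZdGaugeConfig 4 G),
      f n (BoxLabel.rot 3 s p) U = f n p (U ∘ boxEdgeRot n 3 s))
    (hcompat : ∀ (n n' : Fin 4 → ℕ) (h : ∀ i, n i ≤ n' i) (p : BoxLabel n),
      (∀ μ : Fin 4, ((p.1 μ : ℕ) + 1 < n μ) ∨ n μ = n' μ) →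
        ∀ U : ZdGaugeConfig 4 G, f n' (BoxLabel.castLE h p) U = f n p U)
    {a t m : ℕ} (ha : 0 < a) (h2m : 2 * m ≤ t) (hm1 : m + 1 ≤ t) :
    ‖pertLogZ (zdHaar 4 G) (f (![a, a, a, t] : Fin 4 → ℕ))
        (boxSystem (G := G) ρ (![a, a, a, t] : Fin 4 → ℕ)).Adj Finset.univ -
      (t : ℂ) * ∑ 𝒞 ∈ ((rconnSubsets (boxSystem (G := G) ρ (![a, a, a, m + 1] : Fin 4 → ℕ)).Adj
          Finset.univ).powerset.filter fun 𝒞 => ∑ Y ∈ 𝒞, (Y.card : ℝ) < m) with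
            ∀ j ∈ ({3} : Finset (Fin 4)), BoxRooted j m 𝒞,
        truncatedWeight (GeomInc (boxSystem (G := G) ρ (![a, a, a, m + 1] : Fin 4 → ℕ)).Adj)
          (connActivity (boxSystem (G := G) ρ (![a, a, a, m + 1] : Fin 4 → ℕ)).Adj (zdHaar 4 G)
            (f (![a, a, a, m + 1] : Fin 4 → ℕ))) 𝒞‖ ≤
      (a * a * a * t * 6 : ℝ) * Real.exp (-(m : ℝ)) := by
  set nt : Fin 4 → ℕ := ![a, a, a, t] with hnt
  set nr : Fin 4 → ℕ := ![a, a, a, m + 1] with hnr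
  have hε1 : Real.exp 1 * ε * ((boxDeg 4 : ℝ) + 1) ^ 2 ≤ 1 / 2 := smallness_one_of_two' hε hε2
  have hLP := isLocalPerturbation_of_factors (S := boxSystem (G := G) ρ nt) hε (hmeas nt) (hdep nt) (hnorm nt)
  -- tail of the cluster expansion
  have htail := norm_pertLogZ_sub_sum_small_le_of_local (R := (boxSystem (G := G) ρ nt).Adj)
    (card_near_boxSystem_le (ρ := ρ)) (fun x y h => (boxSystem (G := G) ρ nt).mem_near x y h) hLP hε2
    Finset.univ m
  rw [Finset.card_univ, hnt, card_boxLabel_four] at htail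
  -- translation invariance in the time direction
  have hnt3 : 2 * m ≤ nt 3 := h2m
  have hrot' := sum_small_eq_size_mul_sum_of_iff_of_covariant (G := G) (ρ := ρ) (n := nt) hε (hmeas nt) (hdep nt)
    (hnorm nt) hε1 (3 : Fin 4) (hrot nt) hnt3
    (fun _ => True) (fun 𝒞 => ∀ j ∈ ({3} : Finset (Fin 4)), BoxRooted j m 𝒞) (fun _ _ => Iff.rfl)
    (fun 𝒞 => by simp)
  have ht : ((nt 3 : ℕ) : ℂ) = (t : ℂ) := rfl
  rw [Finset.filter_true, ht] at hrot'
  -- independence of the length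
  have hincl : ∑ 𝒞 ∈ ((rconnSubsets (boxSystem (G := G) ρ nr).Adj Finset.univ).powerset.filter
        fun 𝒞 => ∑ Y ∈ 𝒞, (Y.card : ℝ) < m) with ∀ j ∈ ({3} : Finset (Fin 4)), BoxRooted j m 𝒞,
        truncatedWeight (GeomInc (boxSystem (G := G) ρ nr).Adj)
          (connActivity (boxSystem (G := G) ρ nr).Adj (zdHaar 4 G) (f nr)) 𝒞 =
      ∑ 𝒞 ∈ ((rconnSubsets (boxSystem (G := G) ρ nt).Adj Finset.univ).powerset.filter
        fun 𝒞 => ∑ Y ∈ 𝒞, (Y.card : ℝ) < m) with ∀ j ∈ ({3} : Finset (Fin 4)), BoxRooted j m 𝒞,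
        truncatedWeight (GeomInc (boxSystem (G := G) ρ nt).Adj)
          (connActivity (boxSystem (G := G) ρ nt).Adj (zdHaar 4 G) (f nt)) 𝒞 := by
    refine sum_small_boxRooted_eq_of_le_of_compatible (d := 4) (G := G) (ρ := ρ) (tube_sizes_le hm1)
      ({3} : Finset (Fin 4)) tube_sizes_eq_of_ne (m := m)
      (fun i hi => by rw [Finset.mem_singleton.1 hi]; exact le_rfl)
      (tube_sizes_pos ha (Nat.succ_pos m)) (hmeas nr) (hdep nr) fun p hp U => ?_
    refine hcompat nr nt (tube_sizes_le hm1) p (fun μ => ?_) U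
    by_cases hμ : μ = 3
    · subst hμ
      left
      have h3 : BoxLabel.coord 3 p < m := hp 3 (Finset.mem_singleton_self _)
      have e3 : nr 3 = m + 1 := rfl
      unfold BoxLabel.coord at h3
      omega
    · right
      exact tube_sizes_eq_of_ne μ (by simpa using hμ)
  rw [← hincl] at hrot'
  rw [← hrot']
  simpa using htail

open scoped Classical in
/-- **Two tubes: the bulk cancels.**  Under the hypotheses of `norm_pertLogZ_tube_sub_mul_le_of_covariant`, for `t ≥ 1`,
`‖log Z(a³ × 2t) − 2 log Z(a³ × t)‖ ≤ 24 a³ t e^{−⌊t/2⌋}`: both logarithms are `(2t)·E_m`, resp. `2·(t·E_m)`, up to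
tails `12 a³ t e^{−m}` each, with the SAME rooted small-cluster sum `E_m`, `m = ⌊t/2⌋` (bulk free energies cancel exactly in
the purity combination; only clusters of size `≥ ⌊t/2⌋` survive). [Seiler LNP 159 Ch. 3] -/
theorem norm_pertLogZ_two_tubes_le_of_covariant (hε : 0 ≤ ε)
    (hmeas : ∀ (n : Fin 4 → ℕ) (p : BoxLabel n), Measurable (f n p))
    (hdep : ∀ (n : Fin 4 → ℕ) (p : BoxLabel n), DependsOn (f n p) ((p.bonds : Finset (ZdEdge 4)) : Set (ZdEdge 4)))
    (hnorm : ∀ (n : Fin 4 → ℕ) (p : BoxLabel n) (U : ZdGaugeConfig 4 G), ‖f n p U‖ ≤ ε)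
    (hε2 : Real.exp 2 * ε * ((boxDeg 4 : ℝ) + 1) ^ 2 ≤ 1 / 2)
    (hrot : ∀ (n : Fin 4 → ℕ) (s : ℕ) (p : BoxLabel n) (U : ZdGaugeConfig 4 G),
      f n (BoxLabel.rot 3 s p) U = f n p (U ∘ boxEdgeRot n 3 s))
    (hcompat : ∀ (n n' : Fin 4 → ℕ) (h : ∀ i, n i ≤ n' i) (p : BoxLabel n),
      (∀ μ : Fin 4, ((p.1 μ : ℕ) + 1 < n μ) ∨ n μ = n' μ) →
        ∀ U : ZdGaugeConfig 4 G, f n' (BoxLabel.castLE h p) U = f n p U)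
    {a t : ℕ} (ha : 0 < a) (ht : 1 ≤ t) :
    ‖pertLogZ (zdHaar 4 G) (f (![a, a, a, 2 * t] : Fin 4 → ℕ))
        (boxSystem (G := G) ρ (![a, a, a, 2 * t] : Fin 4 → ℕ)).Adj Finset.univ -
      2 * pertLogZ (zdHaar 4 G) (f (![a, a, a, t] : Fin 4 → ℕ))
        (boxSystem (G := G) ρ (![a, a, a, t] : Fin 4 → ℕ)).Adj Finset.univ‖ ≤
      24 * (a : ℝ) ^ 3 * t * Real.exp (-((t / 2 : ℕ) : ℝ)) := by
  set m := t / 2 with hm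
  have h2m : 2 * m ≤ t := Nat.mul_div_le t 2
  have hm1 : m + 1 ≤ t := by omega
  have h1 := norm_pertLogZ_tube_sub_mul_le_of_covariant (G := G) (ρ := ρ) hε hmeas hdep hnorm hε2 hrot hcompat
    ha h2m hm1
  have h2 := norm_pertLogZ_tube_sub_mul_le_of_covariant (G := G) (ρ := ρ) hε hmeas hdep hnorm hε2 hrot hcompat
    ha (t := 2 * t) (m := m) (by omega) (by omega)
  -- abbreviate the common rooted sum
  set E := ∑ 𝒞 ∈ ((rconnSubsets (boxSystem (G := G) ρ (![a, a, a, m + 1] : Fin 4 → ℕ)).Adj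
          Finset.univ).powerset.filter fun 𝒞 => ∑ Y ∈ 𝒞, (Y.card : ℝ) < m) with
            ∀ j ∈ ({3} : Finset (Fin 4)), BoxRooted j m 𝒞,
        truncatedWeight (GeomInc (boxSystem (G := G) ρ (![a, a, a, m + 1] : Fin 4 → ℕ)).Adj)
          (connActivity (boxSystem (G := G) ρ (![a, a, a, m + 1] : Fin 4 → ℕ)).Adj (zdHaar 4 G)
            (f (![a, a, a, m + 1] : Fin 4 → ℕ))) 𝒞 with hE
  set A := pertLogZ (zdHaar 4 G) (f (![a, a, a, t] : Fin 4 → ℕ))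
        (boxSystem (G := G) ρ (![a, a, a, t] : Fin 4 → ℕ)).Adj Finset.univ with hA
  set B := pertLogZ (zdHaar 4 G) (f (![a, a, a, 2 * t] : Fin 4 → ℕ))
        (boxSystem (G := G) ρ (![a, a, a, 2 * t] : Fin 4 → ℕ)).Adj Finset.univ with hB
  have h2' : ‖B - 2 * ((t : ℂ) * E)‖ ≤ (a * a * a * (2 * t : ℕ) * 6 : ℝ) * Real.exp (-(m : ℝ)) := by
    have e : (2 : ℂ) * ((t : ℂ) * E) = ((2 * t : ℕ) : ℂ) * E := by push_cast; ring
    rw [e]; exact h2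
  have hsplit : B - 2 * A = (B - 2 * ((t : ℂ) * E)) - 2 * (A - (t : ℂ) * E) := by ring
  rw [hsplit]
  refine (norm_sub_le _ _).trans ?_
  rw [norm_mul, Complex.norm_two]
  have hX : 0 ≤ Real.exp (-(m : ℝ)) := (Real.exp_pos _).le
  calc ‖B - 2 * ((t : ℂ) * E)‖ + 2 * ‖A - (t : ℂ) * E‖
      ≤ (a * a * a * (2 * t : ℕ) * 6 : ℝ) * Real.exp (-(m : ℝ)) + 2 * ((a * a * a * t * 6 : ℝ) * Real.exp (-(m : ℝ))) :=
        add_le_add h2' (by gcongr)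
    _ = 24 * (a : ℝ) ^ 3 * t * Real.exp (-(m : ℝ)) := by push_cast; ring

end Tube

end Summit.QuantumFields.YangMills.Cruxes.IR.PurityChannelFamily

end
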